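import Literature.AlgebraicTopology.SingularHomology.LocallyFlatCriticalDegreeModel
import Literature.AlgebraicTopology.SingularHomology.CubeSplitHomology
import Mathlib.Topology.OpenPartialHomeomorph.Constructions
import HarnessLib

/-!
# The critical degree of the local homology at a locally flat closed subset, II: boxes of charts

Sequel of `SingularHomology/LocallyFlatCriticalDegreeModel` (C. Voisin, *Hodge Theory I*, §11.1.2,
proof of Lemma 11.13 — the critical degree of "the Thom isomorphism `Hʲ(X, X − Y) ≅ H^{j−2k}(Y)`" —
in the topological, orientation-free form). For a straightening chart `e : X ⇀ F × K` of the closed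
`S ⊆ X` (`z ∈ S ↔ (e z).1 = 0` on `e.source`) and a ball `B((0, y), r) ⊆ e.target` centred on the flat
piece, the BOX `B = e.source ∩ e⁻¹ B((0,y),r)` is an open subset of `X` meeting `S`, homeomorphic as a
pair `(B, B ∖ S)` to the model `(B((0,y),r), B((0,y),r) ∖ L)`. This file transports the model
computations to boxes and records the vanishing below the critical degree on ALL open subsets:

* `relativeSingularHomology.bijective_map_homeomorph` — a homeomorphism of pairs induces bijections on
  relative homology (Hatcher §2.1; congruence in the map is the tree's `LCube.relMap_congr`); `image_box_eq`,
  `preimage_boxHomeomorph`, `mapsTo_boxHomeomorph` — the box as a pair;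
* `exists_forall_mem_span_localHomologyOfSet_box` — `H_k(B | S; R)` is generated by one class
  (`2 ≤ k ≤ dim F`); `exists_range_toAmbient_box_eq_span` — so is its image in `H_k(X | S; R)`;
* `surjective_inclMap_box`, `range_toAmbient_box_eq_of_subset` — nested boxes of ONE chart
  (`B((0,y''),r'') ⊆ B((0,y),r)`, `r'' ≤ r`) have the same image in `H_k(X | S)`;
* `isZero_localHomologyOfSet_of_locallyFlat` — **`H_j(W | S) = 0` for `1 ≤ j < k` and every open
  `W ⊆ X`** when `S` is straightened by charts of normal dimension `≥ k` (restrict the charts to `W`,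
  `OpenPartialHomeomorph.subtypeRestr`, and apply the tree's `surjective_injective_map_compl_of_locallyFlat`
  with the exact sequence of the pair, `isZero_relativeSingularHomology_succ_of_epi_of_mono`): the
  hypothesis of the generation theorem `localHomologyOfSet.mem_iSup_range_toAmbient_of_cover` in
  degree `k`.

Everything is proved; no definitions, no named facts.

## References

* [VoisinHodgeI2002] C. Voisin, Hodge Theory and Complex Algebraic Geometry I, CUP 2002, §11.1.2
  Lemma 11.13 (proof).
* [HatcherAT2002] A. Hatcher, Algebraic Topology, CUP 2002, §2.1 (maps of pairs, Prop. 2.19,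
  Thm. 2.16), §3.3 p. 231.
-/

noncomputable section

open CategoryTheory Limits Set TopologicalSpace Metric

universe u v

namespace Literature.AlgebraicTopology.SingularHomology

variable (R : Type v) [CommRing R] (M : Type v) [AddCommGroup M] [Module R M]

/-! ### Transport to the boxes of a straightening chart -/

section Charts

variable {F K : Type} [NormedAddCommGroup F] [NormedSpace ℝ F] [FiniteDimensional ℝ F]
  [NormedAddCommGroup K] [NormedSpace ℝ K]
variable {X : Type} [TopologicalSpace X] {S : Set X}

/-- **A homeomorphism of pairs induces isomorphisms on relative homology**: for `φ : A ≃ₜ B` with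
`φ ⁻¹' Q = P`, `φ_* : Hₙ(A, P) → Hₙ(B, Q)` is bijective, with inverse `(φ⁻¹)_*` (Hatcher 2002, §2.1).
[cite: HatcherAT2002, §2.1 Prop. 2.19 ff.] -/
theorem relativeSingularHomology.bijective_map_homeomorph {A B : Type u} [TopologicalSpace A]
    [TopologicalSpace B] (φ : A ≃ₜ B) {P : Set A} {Q : Set B} (h : φ ⁻¹' Q = P)
    (hφ : MapsTo (φ : C(A, B)) P Q) (n : ℕ) :
    Function.Bijective (relativeSingularHomology.map R M (φ : C(A, B)) hφ n) := by
  have hψ : MapsTo (φ.symm : C(B, A)) Q P := fun y hy ↦ by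
    change φ.symm y ∈ P
    rw [← h, mem_preimage, φ.apply_symm_apply]
    exact hy
  have h₁ : relativeSingularHomology.map R M (φ : C(A, B)) hφ n ≫
      relativeSingularHomology.map R M (φ.symm : C(B, A)) hψ n = 𝟙 _ := by
    rw [← relativeSingularHomology.map_comp,
      LCube.relMap_congr R M (g := ContinuousMap.id A)
        (ContinuousMap.ext fun x ↦ φ.symm_apply_apply x) _ (mapsTo_id _),
      relativeSingularHomology.map_id]
  have h₂ : relativeSingularHomology.map R M (φ.symm : C(B, A)) hψ n ≫
      relativeSingularHomology.map R M (φ : C(A, B)) hφ n = 𝟙 _ := by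
    rw [← relativeSingularHomology.map_comp,
      LCube.relMap_congr R M (g := ContinuousMap.id B)
        (ContinuousMap.ext fun y ↦ φ.apply_symm_apply y) _ (mapsTo_id _),
      relativeSingularHomology.map_id]
  haveI : IsIso (relativeSingularHomology.map R M (φ : C(A, B)) hφ n) := (Iso.mk _ _ h₁ h₂).isIso_hom
  exact ConcreteCategory.bijective_of_isIso (relativeSingularHomology.map R M (φ : C(A, B)) hφ n)

omit [NormedSpace ℝ F] [FiniteDimensional ℝ F] [NormedSpace ℝ K] in
/-- The image of a box of a chart is the model ball. [folklore] -/
theorem image_box_eq (e : OpenPartialHomeomorph X (F × K)) (y : K) {r : ℝ}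
    (hB : ball ((0 : F), y) r ⊆ e.target) :
    e '' (e.source ∩ e ⁻¹' ball ((0 : F), y) r) = ball ((0 : F), y) r := by
  refine Subset.antisymm ?_ fun p hp ↦ ?_
  · rintro _ ⟨z, ⟨-, hz⟩, rfl⟩
    exact hz
  · exact ⟨e.symm p, ⟨e.map_target (hB hp), by
      rw [mem_preimage, e.right_inv (hB hp)]; exact hp⟩, e.right_inv (hB hp)⟩

omit [NormedSpace ℝ F] [FiniteDimensional ℝ F] [NormedSpace ℝ K] in
/-- **The box of a straightening chart is homeomorphic, as a pair, to the model**: the restriction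
of `e` to `B = e.source ∩ e⁻¹ B((0,y),r)` is a homeomorphism onto `B((0,y),r)` carrying `B ∩ S` onto
the flat piece. [folklore] -/
theorem preimage_boxHomeomorph (e : OpenPartialHomeomorph X (F × K))
    (heS : ∀ z ∈ e.source, z ∈ S ↔ (e z).1 = 0) (y : K) {r : ℝ}
    (hB : ball ((0 : F), y) r ⊆ e.target) :
    (e.homeomorphOfImageSubsetSource (s := e.source ∩ e ⁻¹' ball ((0 : F), y) r)
        inter_subset_left (image_box_eq e y hB)) ⁻¹'
      (Subtype.val ⁻¹' {p : F × K | p.1 = 0} : Set ↥(ball ((0 : F), y) r))ᶜ =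
      (Subtype.val ⁻¹' S : Set ↥(e.source ∩ e ⁻¹' ball ((0 : F), y) r))ᶜ := by
  ext z
  simp only [mem_preimage, mem_compl_iff, mem_setOf_eq]
  exact not_congr (heS z.1 z.2.1).symm

omit [NormedSpace ℝ F] [FiniteDimensional ℝ F] [NormedSpace ℝ K] in
/-- The box homeomorphism is a map of pairs `(B, B ∖ S) → (B((0,y),r), B((0,y),r) ∖ L)`. [folklore] -/
theorem mapsTo_boxHomeomorph (e : OpenPartialHomeomorph X (F × K))
    (heS : ∀ z ∈ e.source, z ∈ S ↔ (e z).1 = 0) (y : K) {r : ℝ}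
    (hB : ball ((0 : F), y) r ⊆ e.target) :
    MapsTo (e.homeomorphOfImageSubsetSource (s := e.source ∩ e ⁻¹' ball ((0 : F), y) r)
        inter_subset_left (image_box_eq e y hB) : C(_, _))
      (Subtype.val ⁻¹' S : Set ↥(e.source ∩ e ⁻¹' ball ((0 : F), y) r))ᶜ
      (Subtype.val ⁻¹' {p : F × K | p.1 = 0} : Set ↥(ball ((0 : F), y) r))ᶜ := by
  intro z hz
  rw [← preimage_boxHomeomorph e heS y hB] at hz
  exact hz

/-- **`H_k(B | S; R)` is generated by one class for a box `B` of a straightening chart**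
(`2 ≤ k ≤ dim F`): transport of `exists_forall_mem_span_localHomologyOfSet_ball` along the chart.
[cite: HatcherAT2002, §2.2 Cor. 2.14 and §3.3 p. 231] -/
theorem exists_forall_mem_span_localHomologyOfSet_box (e : OpenPartialHomeomorph X (F × K))
    (heS : ∀ z ∈ e.source, z ∈ S ↔ (e z).1 = 0) (y : K) {r : ℝ} (hr : 0 < r)
    (hB : ball ((0 : F), y) r ⊆ e.target) {k : ℕ} (hk2 : 2 ≤ k) (hk : k ≤ Module.finrank ℝ F) :
    ∃ θ : localHomologyOfSet R R ↥(e.source ∩ e ⁻¹' ball ((0 : F), y) r) (Subtype.val ⁻¹' S) k,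
      ∀ x, x ∈ Submodule.span R ({θ} : Set _) :=
  exists_forall_mem_span_of_iso R
    (LinearEquiv.ofBijective _ (relativeSingularHomology.bijective_map_homeomorph R R
      (e.homeomorphOfImageSubsetSource inter_subset_left (image_box_eq e y hB))
      (preimage_boxHomeomorph e heS y hB) (mapsTo_boxHomeomorph e heS y hB) k)).toModuleIso.symm
    (exists_forall_mem_span_localHomologyOfSet_ball R y hr hk2 hk)

omit [FiniteDimensional ℝ F] in
/-- **Nested boxes of one chart**: for balls `B((0,y''),r'') ⊆ B((0,y),r) ⊆ e.target` centred on the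
flat piece, `0 < r'' ≤ r`, the map `H_k(B'' | S) → H_k(B | S)` induced by the inclusion of the boxes
`B'' = e.source ∩ e⁻¹B((0,y''),r'') ⊆ B = e.source ∩ e⁻¹B((0,y),r)` is onto for `k ≥ 2` (transport of
`surjective_inclMap_ball`). [cite: HatcherAT2002, §2.1 Thm. 2.16 and Cor. 2.11] -/
theorem surjective_inclMap_box (e : OpenPartialHomeomorph X (F × K))
    (heS : ∀ z ∈ e.source, z ∈ S ↔ (e z).1 = 0) {y'' y : K} {r'' r : ℝ} (hr'' : 0 < r'')
    (hrr : r'' ≤ r) (hsub : ball ((0 : F), y'') r'' ⊆ ball ((0 : F), y) r)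
    (hB : ball ((0 : F), y) r ⊆ e.target) {k : ℕ} (hk2 : 2 ≤ k) :
    Function.Surjective (localHomologyOfSet.inclMap R M (S := S)
      (inter_subset_inter_right e.source (preimage_mono hsub) :
        e.source ∩ e ⁻¹' ball ((0 : F), y'') r'' ⊆ e.source ∩ e ⁻¹' ball ((0 : F), y) r) k) := by
  have hB'' : ball ((0 : F), y'') r'' ⊆ e.target := hsub.trans hB
  -- the two homeomorphisms of pairs and the commuting square with the inclusions
  set ψ := relativeSingularHomology.map R M _ (mapsTo_boxHomeomorph e heS y hB) k with hψdef
  set ψ'' := relativeSingularHomology.map R M _ (mapsTo_boxHomeomorph e heS y'' hB'') k with hψ''def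
  have hψ : Function.Bijective ψ := relativeSingularHomology.bijective_map_homeomorph R M _
    (preimage_boxHomeomorph e heS y hB) (mapsTo_boxHomeomorph e heS y hB) k
  have hψ'' : Function.Bijective ψ'' := relativeSingularHomology.bijective_map_homeomorph R M _
    (preimage_boxHomeomorph e heS y'' hB'') (mapsTo_boxHomeomorph e heS y'' hB'') k
  have hsq : localHomologyOfSet.inclMap R M (S := S)
        (inter_subset_inter_right e.source (preimage_mono hsub)) k ≫ ψ =
      ψ'' ≫ localHomologyOfSet.inclMap R M (S := {p : F × K | p.1 = 0}) hsub k := by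
    change relativeSingularHomology.map R M _ _ k ≫ relativeSingularHomology.map R M _ _ k =
      relativeSingularHomology.map R M _ _ k ≫ relativeSingularHomology.map R M _ _ k
    rw [← relativeSingularHomology.map_comp, ← relativeSingularHomology.map_comp]
    exact LCube.relMap_congr R M (ContinuousMap.ext fun _ ↦ rfl) _ _ k
  have hmodel := surjective_inclMap_ball R M (F := F) (K := K) hr'' hrr hsub hk2
  intro x
  obtain ⟨w, hw⟩ := hmodel (ψ x)
  obtain ⟨v, rfl⟩ := hψ''.2 w
  refine ⟨v, hψ.1 ?_⟩
  change (localHomologyOfSet.inclMap R M _ k ≫ ψ) v = ψ x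
  rw [hsq, ModuleCat.comp_apply]
  exact hw

/-- **The range of a box in `H_k(X | S; R)` is spanned by one class.** [folklore] -/
theorem exists_range_toAmbient_box_eq_span (e : OpenPartialHomeomorph X (F × K))
    (heS : ∀ z ∈ e.source, z ∈ S ↔ (e z).1 = 0) (y : K) {r : ℝ} (hr : 0 < r)
    (hB : ball ((0 : F), y) r ⊆ e.target) {k : ℕ} (hk2 : 2 ≤ k) (hk : k ≤ Module.finrank ℝ F) :
    ∃ θ : localHomologyOfSet R R X S k,
      LinearMap.range (localHomologyOfSet.toAmbient R R S (e.source ∩ e ⁻¹' ball ((0 : F), y) r) k).hom =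
        Submodule.span R {θ} := by
  obtain ⟨θ₀, hθ₀⟩ := exists_forall_mem_span_localHomologyOfSet_box R e heS y hr hB hk2 hk
  refine ⟨localHomologyOfSet.toAmbient R R S _ k θ₀, ?_⟩
  have htop : (⊤ : Submodule R _) = Submodule.span R {θ₀} :=
    (Submodule.eq_top_iff'.2 hθ₀).symm
  rw [LinearMap.range_eq_map, htop, Submodule.map_span, Set.image_singleton]

omit [FiniteDimensional ℝ F] in
/-- **The range of a box does not shrink with the box**: for nested boxes of one chart as in
`surjective_inclMap_box`, the two ranges in `H_k(X | S)` coincide. [folklore] -/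
theorem range_toAmbient_box_eq_of_subset (e : OpenPartialHomeomorph X (F × K))
    (heS : ∀ z ∈ e.source, z ∈ S ↔ (e z).1 = 0) {y'' y : K} {r'' r : ℝ} (hr'' : 0 < r'')
    (hrr : r'' ≤ r) (hsub : ball ((0 : F), y'') r'' ⊆ ball ((0 : F), y) r)
    (hB : ball ((0 : F), y) r ⊆ e.target) {k : ℕ} (hk2 : 2 ≤ k) :
    LinearMap.range (localHomologyOfSet.toAmbient R M S (e.source ∩ e ⁻¹' ball ((0 : F), y'') r'') k).hom =
      LinearMap.range (localHomologyOfSet.toAmbient R M S (e.source ∩ e ⁻¹' ball ((0 : F), y) r) k).hom := by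
  have hinc : e.source ∩ e ⁻¹' ball ((0 : F), y'') r'' ⊆ e.source ∩ e ⁻¹' ball ((0 : F), y) r :=
    inter_subset_inter_right e.source (preimage_mono hsub)
  rw [← localHomologyOfSet.inclMap_comp_toAmbient R M hinc k, ModuleCat.hom_comp, LinearMap.range_comp,
    LinearMap.range_eq_top.2 (surjective_inclMap_box R M e heS hr'' hrr hsub hB hk2), Submodule.map_top]

end Charts

/-! ### Vanishing below the critical degree on every open subset -/

section OpenSubsets

variable {X : Type} [TopologicalSpace X] {S : Set X}

/-- **`H_j(W | S) = 0` for `1 ≤ j < k` and EVERY open `W ⊆ X`** when the closed `S` is straightened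
by charts of normal dimension `≥ k`: the open subspace `W` with its closed subset `S ∩ W` is again
second countable and straightened (restrict the charts, `OpenPartialHomeomorph.subtypeRestr`), so
`H_j(W ∖ S) → H_j(W)` is onto and `H_{j-1}(W ∖ S) → H_{j-1}(W)` is one-to-one
(`surjective_injective_map_compl_of_locallyFlat`), and the long exact sequence of the pair
concludes (`isZero_relativeSingularHomology_succ_of_epi_of_mono`). This is the vanishing hypothesis
of the generation theorem `localHomologyOfSet.mem_iSup_range_toAmbient_of_cover` in degree `k`.
[cite: VoisinHodgeI2002, §11.1.2 Lemma 11.13] [cite: HatcherAT2002, §2.1 Thm. 2.16] -/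
theorem isZero_localHomologyOfSet_of_locallyFlat [SecondCountableTopology X] (hS : IsClosed S)
    (k : ℕ)
    (hflat : ∀ x ∈ S, ∃ (F : Type) (_ : NormedAddCommGroup F) (_ : NormedSpace ℝ F)
      (_ : FiniteDimensional ℝ F) (K : Type) (_ : NormedAddCommGroup K) (_ : NormedSpace ℝ K)
      (e : OpenPartialHomeomorph X (F × K)),
      k ≤ Module.finrank ℝ F ∧ x ∈ e.source ∧ ∀ z ∈ e.source, z ∈ S ↔ (e z).1 = 0)
    {W : Set X} (hW : IsOpen W) {j : ℕ} (hj1 : 1 ≤ j) (hjk : j < k) :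
    IsZero (localHomologyOfSet R M (↥W) (Subtype.val ⁻¹' S) j) := by
  -- the open subspace `W` with its closed subset `S ∩ W` is again straightened, by restriction
  have hS' : IsClosed (Subtype.val ⁻¹' S : Set ↥W) := hS.preimage continuous_subtype_val
  have hflat' : ∀ x ∈ (Subtype.val ⁻¹' S : Set ↥W), ∃ (F : Type) (_ : NormedAddCommGroup F)
      (_ : NormedSpace ℝ F) (_ : FiniteDimensional ℝ F) (K : Type) (_ : NormedAddCommGroup K)
      (_ : NormedSpace ℝ K) (e : OpenPartialHomeomorph ↥W (F × K)),
      k ≤ Module.finrank ℝ F ∧ x ∈ e.source ∧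
        ∀ z ∈ e.source, z ∈ (Subtype.val ⁻¹' S : Set ↥W) ↔ (e z).1 = 0 := by
    intro x hx
    obtain ⟨F, i₁, i₂, i₃, K, i₄, i₅, e, hkF, hxe, heS⟩ := hflat x.1 hx
    have hne : Nonempty (⟨W, hW⟩ : Opens X) := ⟨⟨x.1, x.2⟩⟩
    let e' : OpenPartialHomeomorph ↥W (F × K) := e.subtypeRestr (s := ⟨W, hW⟩) hne
    have he's : e'.source = Subtype.val ⁻¹' e.source :=
      OpenPartialHomeomorph.subtypeRestr_source e hne
    have he'a : ∀ z : ↥W, e' z = e z.1 := fun z ↦ rfl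
    refine ⟨F, i₁, i₂, i₃, K, i₄, i₅, e', hkF, ?_, ?_⟩
    · rw [he's]
      exact hxe
    · intro z hz
      rw [he's] at hz
      rw [he'a]
      exact heS z.1 hz
  obtain ⟨hsurj, hinj⟩ := surjective_injective_map_compl_of_locallyFlat R M hS' k hflat'
  obtain ⟨i, rfl⟩ : ∃ i, j = i + 1 := ⟨j - 1, by omega⟩
  haveI : Epi (singularHomology.map R M (subsetIncl (Subtype.val ⁻¹' S : Set ↥W)ᶜ) (i + 1)) :=
    (ModuleCat.epi_iff_surjective _).2 (hsurj (i + 1) hjk)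
  haveI : Mono (singularHomology.map R M (subsetIncl (Subtype.val ⁻¹' S : Set ↥W)ᶜ) i) :=
    (ModuleCat.mono_iff_injective _).2 (hinj i (by omega))
  exact isZero_relativeSingularHomology_succ_of_epi_of_mono R M (Subtype.val ⁻¹' S : Set ↥W)ᶜ i

end OpenSubsets

end Literature.AlgebraicTopology.SingularHomology

end
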